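import Summits.NavierStokesRegularity.NavierStokesRegularity.Theorems.CoriolisHeadNoCoRotatingCoreUniformGradient
import Literature.Analysis.FluidPDE.ClassicalLocalEnergyNoJump
import Literature.Analysis.FluidPDE.LocalLerayDifferenceEnergy
import Mathlib.MeasureTheory.Measure.Haar.NormedSpace
import HarnessLib

/-!
# CoriolisHeadLocalEnergyDensitySlices — crux `NoCoRotatingCore` (stmt-NavierStokesRegularity-22676), line
# `local_energy_rescue` (crux workfile, ns-idea-10 g3), stub S2 `stub_densityBootstrap` — file 1: the physical
# slices of a Pineau–Vicol profile in similarity variables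

For a smooth profile `V` and the physical rotated self-similar field `u = pvAnsatz α V`,
`u(t,x) = (−t)^{−1/2} R(θ_t) V(R(−θ_t) x/√(−t))` (`θ_t = −α log(−t)`, `R = rotZ`), with pressure
`p(t,x) = (−t)^{−1} Q(R(−θ_t)x/√(−t))`, this file computes the integrals over physical balls that enter the
local energy identity against a fixed cut-off, in terms of integrals of the profile over the corresponding balls
in similarity variables (change of variables `x = √(−t) R(θ_t) y`, Jacobian `(−t)^{3/2}`, centre
`z_t = R(−θ_t)x₀/√(−t)`, radius `r/√(−t)`):

* `integral_comp_smul_rotZ`, `setIntegral_ball_comp_smul_rotZ` — the change of variables;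
* `pvAnsatz_apply_smul_rotZ`, `orbitPressure_apply_smul_rotZ` — the field and the pressure read in `y`;
* `setIntegral_ball_norm_sq_pvAnsatz` (`= √(−t) ∫_{B(z_t, r/√(−t))} ‖V‖²`),
  `setIntegral_ball_norm_cube_pvAnsatz` (`= ∫ ‖V‖³`), `setIntegral_ball_pressure_pvAnsatz`
  (`∫ |p − m/(−t)|‖u‖ = ∫ |Q − m|‖V‖`).

HONEST FRAMING.  Bookkeeping for an unregistered line's stub (S2); nothing here proves `NoCoRotatingCore` or NS
regularity.

References: D. Chae, J. Wolf, arXiv:1610.09464, §2 Step 2 (2.4f) [ChaeWolf2017RemovingDSS]; B. Pineau, V. Vicol,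
arXiv:2607.09619, (1.7) [PineauVicol2026]; line card `Cruxes/NoCoRotatingCore/Lines/local_energy_rescue.md`.
-/

noncomputable section

open MeasureTheory Set Function Filter Topology Metric InnerProductSpace Real
open scoped RealInnerProductSpace Laplacian ContDiff Topology

-- the summit and its single sub-problem share the name (CONVENTIONS §1), as in every Theorems file
set_option linter.dupNamespace false

namespace Summit.NavierStokesRegularity.NavierStokesRegularity.Theorems.CoriolisHead

namespace LocalEnergyRescue

open Literature.Analysis.FluidPDE

/-! ## §1 The change of variables `x = c • R_θ y` -/

/-- `∫ g(c R_θ y) dy = c⁻³ ∫ g(x) dx` for `c > 0` (rotations preserve Lebesgue measure, dilations scale it by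
`c³`). [folklore] -/
theorem integral_comp_smul_rotZ (g : EuclideanSpace ℝ (Fin 3) → ℝ) {c : ℝ} (hc : 0 < c) (θ : ℝ) :
    ∫ y, g (c • rotZ θ y) = (c ^ 3)⁻¹ * ∫ x, g x := by
  have h1 : ∫ y, g (c • rotZ θ y) = ∫ x, g (c • x) := by
    have hmp := (rotZLIE θ).measurePreserving
    have h := hmp.integral_comp (rotZLIE θ).toHomeomorph.measurableEmbedding (fun x => g (c • x))
    simpa using h
  rw [h1, Measure.integral_comp_smul_of_nonneg volume g c (hR := hc.le), finrank_euclideanSpace_fin,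
    smul_eq_mul]

/-- The centre in similarity variables: `c • R_θ z = x₀` for `z = c⁻¹ • R_{−θ} x₀` (the rotations
`rotZLIE θ` are linear isometries with inverse `rotZ (−θ)`; tree `rotZ_apply_rotZ_neg`, `rotZ_smul`). [folklore] -/
theorem smul_rotZ_center {c : ℝ} (hc : c ≠ 0) (θ : ℝ) (x₀ : EuclideanSpace ℝ (Fin 3)) :
    c • rotZ θ (c⁻¹ • rotZ (-θ) x₀) = x₀ := by
  have e1 : rotZ θ (c⁻¹ • rotZ (-θ) x₀) = c⁻¹ • rotZ θ (rotZ (-θ) x₀) := by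
    rw [← rotZLIE_apply, LinearIsometryEquiv.map_smul, rotZLIE_apply]
  have e2 : rotZ θ (rotZ (-θ) x₀) = x₀ := by simpa using (rotZLIE θ).apply_symm_apply x₀
  rw [e1, smul_smul, mul_inv_cancel₀ hc, one_smul, e2]

/-- Distances under `y ↦ c R_θ y`: `dist (c R_θ y) x₀ = c · dist y z`, `z = c⁻¹ R_{−θ} x₀`, `c > 0`. [folklore] -/
theorem dist_smul_rotZ_eq {c : ℝ} (hc : 0 < c) (θ : ℝ) (x₀ y : EuclideanSpace ℝ (Fin 3)) :
    dist (c • rotZ θ y) x₀ = c * dist y (c⁻¹ • rotZ (-θ) x₀) := by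
  set z := c⁻¹ • rotZ (-θ) x₀ with hz
  have hx₀ : x₀ = c • rotZ θ z := (smul_rotZ_center hc.ne' θ x₀).symm
  rw [dist_eq_norm, dist_eq_norm, hx₀, ← smul_sub]
  have e : rotZ θ y - rotZ θ z = rotZ θ (y - z) := by
    rw [← rotZLIE_apply, ← rotZLIE_apply, ← rotZLIE_apply, map_sub]
  rw [e, norm_smul, Real.norm_of_nonneg hc.le, norm_rotZ]

/-- **Change of variables on a ball**: `∫_{B(x₀,r)} g = c³ ∫_{B(z, r/c)} g(c R_θ y) dy`, `z = c⁻¹ R_{−θ} x₀`,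
`c > 0`. [folklore] -/
theorem setIntegral_ball_comp_smul_rotZ (g : EuclideanSpace ℝ (Fin 3) → ℝ) {c : ℝ} (hc : 0 < c) (θ : ℝ)
    (x₀ : EuclideanSpace ℝ (Fin 3)) (r : ℝ) :
    ∫ x in ball x₀ r, g x =
      c ^ 3 * ∫ y in ball (c⁻¹ • rotZ (-θ) x₀) (r / c), g (c • rotZ θ y) := by
  set z := c⁻¹ • rotZ (-θ) x₀ with hz
  rw [← integral_indicator measurableSet_ball, ← integral_indicator measurableSet_ball]
  have key : ∀ y, (ball z (r / c)).indicator (fun y => g (c • rotZ θ y)) y =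
      (ball x₀ r).indicator g (c • rotZ θ y) := by
    intro y
    have hmem : y ∈ ball z (r / c) ↔ c • rotZ θ y ∈ ball x₀ r := by
      rw [mem_ball, mem_ball, dist_smul_rotZ_eq hc θ x₀ y, ← hz, lt_div_iff₀ hc, mul_comm]
    by_cases hy : y ∈ ball z (r / c)
    · rw [indicator_of_mem hy, indicator_of_mem (hmem.1 hy)]
    · rw [indicator_of_notMem hy, indicator_of_notMem (fun h => hy (hmem.2 h))]
  simp_rw [key]
  rw [integral_comp_smul_rotZ _ hc θ]
  have hc3 : c ^ 3 ≠ 0 := by positivity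
  field_simp

/-! ## §2 The physical field and pressure read in similarity variables -/

section Slices

variable {α : ℝ} {V : EuclideanSpace ℝ (Fin 3) → EuclideanSpace ℝ (Fin 3)}
  {Q : EuclideanSpace ℝ (Fin 3) → ℝ}

/-- **The ansatz on its own slice**: at `x = √(−t) R_θ y`, `θ = −α log(−t)`,
`u(t,x) = (−t)^{−1/2} R_θ V(y)`. [cite: PineauVicol2026, (1.7) (arXiv:2607.09619 p. 3)] -/
theorem pvAnsatz_apply_smul_rotZ {t : ℝ} (ht : t < 0) (y : EuclideanSpace ℝ (Fin 3)) :
    pvAnsatz α (fun y _ => V y) t (Real.sqrt (-t) • rotZ (α * -Real.log (-t)) y) =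
      (Real.sqrt (-t))⁻¹ • rotZ (α * -Real.log (-t)) (V y) := by
  have hc : 0 < Real.sqrt (-t) := Real.sqrt_pos.2 (by linarith)
  have hrot : rotZ (-(α * -Real.log (-t))) (rotZ (α * -Real.log (-t)) y) = y := by
    simpa using (rotZLIE (α * -Real.log (-t))).symm_apply_apply y
  simp only [pvAnsatz]
  rw [smul_smul, inv_mul_cancel₀ hc.ne', one_smul, hrot]

/-- Its norm: `‖u(t, √(−t) R_θ y)‖ = ‖V y‖/√(−t)`. [folklore] -/
theorem norm_pvAnsatz_apply_smul_rotZ {t : ℝ} (ht : t < 0) (y : EuclideanSpace ℝ (Fin 3)) :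
    ‖pvAnsatz α (fun y _ => V y) t (Real.sqrt (-t) • rotZ (α * -Real.log (-t)) y)‖ =
      (Real.sqrt (-t))⁻¹ * ‖V y‖ := by
  rw [pvAnsatz_apply_smul_rotZ ht, norm_smul, norm_inv, Real.norm_of_nonneg (Real.sqrt_nonneg _),
    norm_rotZ]

/-- **The orbit pressure on the slice**: `p(t, √(−t) R_θ y) = (−t)⁻¹ Q(y)`. [folklore] -/
theorem orbitPressure_apply_smul_rotZ {t : ℝ} (ht : t < 0) (y : EuclideanSpace ℝ (Fin 3)) :
    ofLerayOrbitPressure (fun (s : ℝ) (y : EuclideanSpace ℝ (Fin 3)) => Q (rotZ (-(α * s)) y)) t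
        (Real.sqrt (-t) • rotZ (α * -Real.log (-t)) y) = (-t)⁻¹ * Q y := by
  have hc : 0 < Real.sqrt (-t) := Real.sqrt_pos.2 (by linarith)
  have hrot : rotZ (-(α * -Real.log (-t))) (rotZ (α * -Real.log (-t)) y) = y := by
    simpa using (rotZLIE (α * -Real.log (-t))).symm_apply_apply y
  simp only [ofLerayOrbitPressure]
  rw [smul_smul, inv_mul_cancel₀ hc.ne', one_smul, hrot]

/-! ## §3 Ball integrals of the slices -/

/-- **Local energy of a slice**: `∫_{B(x₀,r)} ‖u(t)‖² = √(−t) ∫_{B(z_t, r/√(−t))} ‖V‖²`,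
`z_t = R_{−θ_t}x₀/√(−t)`. [cite: ChaeWolf2017RemovingDSS, §2 (2.4f) (arXiv p. 5)] -/
theorem setIntegral_ball_norm_sq_pvAnsatz {t : ℝ} (ht : t < 0) (x₀ : EuclideanSpace ℝ (Fin 3)) (r : ℝ) :
    ∫ x in ball x₀ r, ‖pvAnsatz α (fun y _ => V y) t x‖ ^ 2 =
      Real.sqrt (-t) * ∫ y in ball ((Real.sqrt (-t))⁻¹ • rotZ (-(α * -Real.log (-t))) x₀)
        (r / Real.sqrt (-t)), ‖V y‖ ^ 2 := by
  have hc : 0 < Real.sqrt (-t) := Real.sqrt_pos.2 (by linarith)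
  rw [setIntegral_ball_comp_smul_rotZ _ hc (α * -Real.log (-t)) x₀ r]
  simp_rw [norm_pvAnsatz_apply_smul_rotZ ht]
  have e : ∀ y, ((Real.sqrt (-t))⁻¹ * ‖V y‖) ^ 2 = (Real.sqrt (-t) ^ 2)⁻¹ * ‖V y‖ ^ 2 := fun y => by
    rw [mul_pow, inv_pow]
  simp_rw [e]
  rw [integral_const_mul]
  field_simp

/-- **Cubic term of a slice**: `∫_{B(x₀,r)} ‖u(t)‖³ = ∫_{B(z_t, r/√(−t))} ‖V‖³` (scale invariant). [folklore] -/
theorem setIntegral_ball_norm_cube_pvAnsatz {t : ℝ} (ht : t < 0) (x₀ : EuclideanSpace ℝ (Fin 3)) (r : ℝ) :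
    ∫ x in ball x₀ r, ‖pvAnsatz α (fun y _ => V y) t x‖ ^ 3 =
      ∫ y in ball ((Real.sqrt (-t))⁻¹ • rotZ (-(α * -Real.log (-t))) x₀)
        (r / Real.sqrt (-t)), ‖V y‖ ^ 3 := by
  have hc : 0 < Real.sqrt (-t) := Real.sqrt_pos.2 (by linarith)
  rw [setIntegral_ball_comp_smul_rotZ _ hc (α * -Real.log (-t)) x₀ r]
  simp_rw [norm_pvAnsatz_apply_smul_rotZ ht]
  have e : ∀ y, ((Real.sqrt (-t))⁻¹ * ‖V y‖) ^ 3 = (Real.sqrt (-t) ^ 3)⁻¹ * ‖V y‖ ^ 3 := fun y => by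
    rw [mul_pow, inv_pow]
  simp_rw [e]
  rw [integral_const_mul, ← mul_assoc, mul_inv_cancel₀ (by positivity), one_mul]

/-- **Pressure flux of a slice, gauged**: `∫_{B(x₀,r)} |p(t) − m/(−t)|‖u(t)‖ = ∫_{B(z_t, r/√(−t))} |Q − m|‖V‖`
(scale invariant). [folklore] -/
theorem setIntegral_ball_pressure_pvAnsatz {t : ℝ} (ht : t < 0) (x₀ : EuclideanSpace ℝ (Fin 3)) (r m : ℝ) :
    ∫ x in ball x₀ r, |ofLerayOrbitPressure
        (fun (s : ℝ) (y : EuclideanSpace ℝ (Fin 3)) => Q (rotZ (-(α * s)) y)) t x - (-t)⁻¹ * m| *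
        ‖pvAnsatz α (fun y _ => V y) t x‖ =
      ∫ y in ball ((Real.sqrt (-t))⁻¹ • rotZ (-(α * -Real.log (-t))) x₀)
        (r / Real.sqrt (-t)), |Q y - m| * ‖V y‖ := by
  have ht' : 0 < -t := by linarith
  have hc : 0 < Real.sqrt (-t) := Real.sqrt_pos.2 ht'
  rw [setIntegral_ball_comp_smul_rotZ _ hc (α * -Real.log (-t)) x₀ r]
  simp_rw [norm_pvAnsatz_apply_smul_rotZ ht, orbitPressure_apply_smul_rotZ ht]
  have e : ∀ y, |(-t)⁻¹ * Q y - (-t)⁻¹ * m| * ((Real.sqrt (-t))⁻¹ * ‖V y‖) =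
      ((-t)⁻¹ * (Real.sqrt (-t))⁻¹) * (|Q y - m| * ‖V y‖) := fun y => by
    rw [← mul_sub, abs_mul, abs_of_pos (inv_pos.2 ht')]
    ring
  simp_rw [e]
  rw [integral_const_mul, ← mul_assoc]
  have hsq : Real.sqrt (-t) ^ 2 = -t := Real.sq_sqrt ht'.le
  have e2 : Real.sqrt (-t) ^ 3 * ((-t)⁻¹ * (Real.sqrt (-t))⁻¹) = 1 := by
    rw [pow_succ, hsq]
    calc -t * Real.sqrt (-t) * ((-t)⁻¹ * (Real.sqrt (-t))⁻¹)
        = (-t * (-t)⁻¹) * (Real.sqrt (-t) * (Real.sqrt (-t))⁻¹) := by ring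
      _ = 1 := by rw [mul_inv_cancel₀ ht'.ne', mul_inv_cancel₀ hc.ne', one_mul]
  rw [e2, one_mul]

end Slices

/-! ## §4 Integrability on balls and an AM–GM splitting -/

/-- AM–GM: `ab ≤ (τ/2)a² + b²/(2τ)` for `τ > 0`. [folklore] -/
theorem mul_le_amgm {a b τ : ℝ} (hτ : 0 < τ) : a * b ≤ τ / 2 * a ^ 2 + 1 / (2 * τ) * b ^ 2 := by
  have h : 0 ≤ (τ * a - b) ^ 2 / (2 * τ) := by positivity
  have e : (τ * a - b) ^ 2 / (2 * τ) = τ / 2 * a ^ 2 + 1 / (2 * τ) * b ^ 2 - a * b := by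
    field_simp
    ring
  linarith [e ▸ h]

/-- **The gauged pressure–velocity product on a ball, from `BMO₂` of the pressure and the local energy**:
`∫_B |Q − m|‖V‖ ≤ (τ/2)∫_B (Q − m)² + (1/(2τ))∫_B ‖V‖²`. [folklore] -/
theorem setIntegral_abs_sub_mul_norm_le {Q : EuclideanSpace ℝ (Fin 3) → ℝ}
    {V : EuclideanSpace ℝ (Fin 3) → EuclideanSpace ℝ (Fin 3)} (hQ : Continuous Q) (hV : Continuous V)
    (z : EuclideanSpace ℝ (Fin 3)) (ρ m : ℝ) {τ : ℝ} (hτ : 0 < τ) :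
    ∫ y in ball z ρ, |Q y - m| * ‖V y‖ ≤
      τ / 2 * (∫ y in ball z ρ, (Q y - m) ^ 2) + 1 / (2 * τ) * ∫ y in ball z ρ, ‖V y‖ ^ 2 := by
  have i1 : IntegrableOn (fun y => |Q y - m| * ‖V y‖) (ball z ρ) volume :=
    (((continuous_abs.comp (hQ.sub continuous_const)).mul hV.norm).continuousOn.integrableOn_compact
      (isCompact_closedBall z ρ)).mono_set ball_subset_closedBall
  have i2 : IntegrableOn (fun y => (Q y - m) ^ 2) (ball z ρ) volume :=
    (((hQ.sub continuous_const).pow 2).continuousOn.integrableOn_compact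
      (isCompact_closedBall z ρ)).mono_set ball_subset_closedBall
  have i3 : IntegrableOn (fun y => ‖V y‖ ^ 2) (ball z ρ) volume :=
    ((hV.norm.pow 2).continuousOn.integrableOn_compact (isCompact_closedBall z ρ)).mono_set
      ball_subset_closedBall
  rw [← integral_const_mul, ← integral_const_mul, ← integral_add (i2.const_mul _) (i3.const_mul _)]
  refine setIntegral_mono_on i1 ((i2.const_mul _).add (i3.const_mul _)) measurableSet_ball fun y _ => ?_
  have h := mul_le_amgm (a := |Q y - m|) (b := ‖V y‖) hτ
  rwa [sq_abs] at h

/-! ## §5 The flux of a slice through a translated cut-off, in similarity variables -/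

section Flux

variable {α : ℝ} {V : EuclideanSpace ℝ (Fin 3) → EuclideanSpace ℝ (Fin 3)}
  {Q : EuclideanSpace ℝ (Fin 3) → ℝ}

/-- A weight supported in `B(x₀, R)` and bounded by `B` there integrates a nonnegative continuous `g` to at most
`B ∫_{B(x₀,R)} g`. [folklore] -/
theorem integral_weight_mul_le {w g : EuclideanSpace ℝ (Fin 3) → ℝ} {x₀ : EuclideanSpace ℝ (Fin 3)} {R B : ℝ}
    (hwB : ∀ x, |w x| ≤ B) (hw0 : ∀ x, x ∉ ball x₀ R → w x = 0) (hg : Continuous g) (hg0 : ∀ x, 0 ≤ g x)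
    (hwg : Integrable (fun x => w x * g x)) :
    ∫ x, w x * g x ≤ B * ∫ x in ball x₀ R, g x := by
  have hB0 : 0 ≤ B := (abs_nonneg _).trans (hwB x₀)
  have e : ∫ x, w x * g x = ∫ x in ball x₀ R, w x * g x := by
    refine (setIntegral_eq_integral_of_forall_compl_eq_zero fun x hx => ?_).symm
    rw [hw0 x hx, zero_mul]
  rw [e, ← integral_const_mul]
  refine setIntegral_mono_on hwg.integrableOn (((hg.continuousOn.integrableOn_compact (isCompact_closedBall x₀ R)).mono_set
      ball_subset_closedBall).const_mul B)
    measurableSet_ball fun x _ => ?_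
  calc w x * g x ≤ |w x| * g x := mul_le_mul_of_nonneg_right (le_abs_self _) (hg0 x)
    _ ≤ B * g x := mul_le_mul_of_nonneg_right (hwB x) (hg0 x)

/-- **The flux of one slice, in similarity variables.**  Let `(V, Q)` be a smooth Pineau–Vicol profile,
`u = pvAnsatz α V`, `p` its orbit pressure, `φ = φ₀(· − x₀)` a translated test function with `|Δφ|, ‖Dφ‖ ≤ B`
vanishing off `B(x₀, R)`.  For `t < 0`, with `c = √(−t)`, `z = c⁻¹R_{−θ}x₀`, `ρ = R/c` and any gauge `m`:
`∫ (Δφ|u|² + Dφ(u)|u|² + 2pDφ(u)) ≤ B c ∫_{B(z,ρ)}‖V‖² + B ∫_{B(z,ρ)}‖V‖³ + 2B ∫_{B(z,ρ)}|Q − m|‖V‖`.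
[cite: ChaeWolf2017RemovingDSS, §2 Step 2 (2.4f) (arXiv p. 5)] -/
theorem flux_slice_le (hV : ContDiff ℝ ∞ V) (hQ : ContDiff ℝ ∞ Q) (hdiv : VectorCalculus.IsDivFree V)
    (heq : ∀ y : EuclideanSpace ℝ (Fin 3), α • (rotGen (V y) - fderiv ℝ V y (rotGen y)) +
      (1 / 2 : ℝ) • V y + (1 / 2 : ℝ) • fderiv ℝ V y y - (Δ V) y + fderiv ℝ V y (V y) +
      gradient Q y = 0)
    {φ : EuclideanSpace ℝ (Fin 3) → ℝ} (hφ : ContDiff ℝ ∞ φ) (hφc : HasCompactSupport φ)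
    {x₀ : EuclideanSpace ℝ (Fin 3)} {R B : ℝ}
    (hDφ : ∀ x, ‖fderiv ℝ φ x‖ ≤ B) (hΔφ : ∀ x, |(Δ φ) x| ≤ B)
    (hD0 : ∀ x, x ∉ ball x₀ R → fderiv ℝ φ x = 0) (hΔ0 : ∀ x, x ∉ ball x₀ R → (Δ φ) x = 0)
    {t : ℝ} (ht : t < 0) (m : ℝ) :
    ∫ x, ((1 : ℝ) * ((Δ φ) x * ‖pvAnsatz α (fun y _ => V y) t x‖ ^ 2) +
        fderiv ℝ φ x (pvAnsatz α (fun y _ => V y) t x) * ‖pvAnsatz α (fun y _ => V y) t x‖ ^ 2 +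
        2 * (ofLerayOrbitPressure (fun (s : ℝ) (y : EuclideanSpace ℝ (Fin 3)) => Q (rotZ (-(α * s)) y)) t x *
          fderiv ℝ φ x (pvAnsatz α (fun y _ => V y) t x))) ≤
      B * (Real.sqrt (-t) * ∫ y in ball ((Real.sqrt (-t))⁻¹ • rotZ (-(α * -Real.log (-t))) x₀)
          (R / Real.sqrt (-t)), ‖V y‖ ^ 2) +
      B * (∫ y in ball ((Real.sqrt (-t))⁻¹ • rotZ (-(α * -Real.log (-t))) x₀)
          (R / Real.sqrt (-t)), ‖V y‖ ^ 3) +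
      2 * B * (∫ y in ball ((Real.sqrt (-t))⁻¹ • rotZ (-(α * -Real.log (-t))) x₀)
          (R / Real.sqrt (-t)), |Q y - m| * ‖V y‖) := by
  set u := pvAnsatz α (fun y _ => V y) with hu
  set p := ofLerayOrbitPressure (fun (s : ℝ) (y : EuclideanSpace ℝ (Fin 3)) => Q (rotZ (-(α * s)) y))
    with hp
  have hNS : IsClassicalNSSolutionOn (Iio 0) 1 0 u p :=
    isClassicalNSSolutionOn_pvAnsatz_of_profile (α := α) hV hQ hdiv heq
  have hB0 : 0 ≤ B := (norm_nonneg _).trans (hDφ x₀)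
  -- the tree's gauged flux bound
  have hflux := hNS.integral_flux_le hφ hφc (t := t) ht ((-t)⁻¹ * m)
  rw [abs_one, one_mul] at hflux
  have hu_c : Continuous (u t) := (hNS.contDiff_velocity ht).continuous
  have hp_c : Continuous (p t) := (hNS.contDiff_pressure ht).continuous
  have hφ2 : ContDiff ℝ 2 φ := hφ.of_le (by norm_cast)
  have hφ1 : ContDiff ℝ 1 φ := hφ.of_le (by norm_cast)
  have hΔc : Continuous (Δ φ) := continuous_laplacian hφ2
  have hDc : Continuous (fderiv ℝ φ) := hφ1.continuous_fderiv one_ne_zero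
  -- the three weights and their integrals
  have hout : ∀ x, x ∉ closedBall x₀ R → x ∉ ball x₀ R := fun x hx h => hx (ball_subset_closedBall h)
  have h1 : ∫ x, |(Δ φ) x| * ‖u t x‖ ^ 2 ≤ B * ∫ x in ball x₀ R, ‖u t x‖ ^ 2 := by
    have cW : Continuous fun x => |(Δ φ) x| * ‖u t x‖ ^ 2 := (continuous_abs.comp hΔc).mul (hu_c.norm.pow 2)
    have cg : Continuous fun x => ‖u t x‖ ^ 2 := hu_c.norm.pow 2
    refine integral_weight_mul_le (fun x => by rw [abs_abs]; exact hΔφ x)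
      (fun x hx => by rw [hΔ0 x hx, abs_zero]) cg (fun x => by positivity) ?_
    refine cW.integrable_of_hasCompactSupport
      (HasCompactSupport.intro (K := closedBall x₀ R) (isCompact_closedBall x₀ R) fun x hx => ?_)
    show |(Δ φ) x| * ‖u t x‖ ^ 2 = 0
    rw [hΔ0 x (hout x hx), abs_zero, zero_mul]
  have h2 : ∫ x, ‖fderiv ℝ φ x‖ * ‖u t x‖ ^ 3 ≤ B * ∫ x in ball x₀ R, ‖u t x‖ ^ 3 := by
    have cW : Continuous fun x => ‖fderiv ℝ φ x‖ * ‖u t x‖ ^ 3 := hDc.norm.mul (hu_c.norm.pow 3)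
    have cg : Continuous fun x => ‖u t x‖ ^ 3 := hu_c.norm.pow 3
    refine integral_weight_mul_le (fun x => by rw [abs_norm]; exact hDφ x)
      (fun x hx => by rw [hD0 x hx, norm_zero]) cg (fun x => by positivity) ?_
    refine cW.integrable_of_hasCompactSupport
      (HasCompactSupport.intro (K := closedBall x₀ R) (isCompact_closedBall x₀ R) fun x hx => ?_)
    show ‖fderiv ℝ φ x‖ * ‖u t x‖ ^ 3 = 0
    rw [hD0 x (hout x hx), norm_zero, zero_mul]
  have h3 : ∫ x, |p t x - (-t)⁻¹ * m| * ‖fderiv ℝ φ x‖ * ‖u t x‖ ≤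
      B * ∫ x in ball x₀ R, |p t x - (-t)⁻¹ * m| * ‖u t x‖ := by
    have e : ∀ x, |p t x - (-t)⁻¹ * m| * ‖fderiv ℝ φ x‖ * ‖u t x‖ =
        ‖fderiv ℝ φ x‖ * (|p t x - (-t)⁻¹ * m| * ‖u t x‖) := fun x => by ring
    simp_rw [e]
    have cg : Continuous fun x => |p t x - (-t)⁻¹ * m| * ‖u t x‖ :=
      (continuous_abs.comp (hp_c.sub continuous_const)).mul hu_c.norm
    have cW : Continuous fun x => ‖fderiv ℝ φ x‖ * (|p t x - (-t)⁻¹ * m| * ‖u t x‖) := hDc.norm.mul cg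
    refine integral_weight_mul_le (fun x => by rw [abs_norm]; exact hDφ x)
      (fun x hx => by rw [hD0 x hx, norm_zero]) cg (fun x => by positivity) ?_
    refine cW.integrable_of_hasCompactSupport
      (HasCompactSupport.intro (K := closedBall x₀ R) (isCompact_closedBall x₀ R) fun x hx => ?_)
    show ‖fderiv ℝ φ x‖ * (|p t x - (-t)⁻¹ * m| * ‖u t x‖) = 0
    rw [hD0 x (hout x hx), norm_zero, zero_mul]
  -- read the three ball integrals in similarity variables
  rw [hu, setIntegral_ball_norm_sq_pvAnsatz ht] at h1
  rw [hu, setIntegral_ball_norm_cube_pvAnsatz ht] at h2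
  rw [hu, hp, setIntegral_ball_pressure_pvAnsatz ht] at h3
  linarith [hflux, h1, h2, h3]

/-- **The local energy of a slice dominates the profile energy of the inner ball**: if `0 ≤ φ` and
`φ = 1` on `B(x₀, 1)` then `∫ φ|u(t)|² ≥ √(−t) ∫_{B(z_t, 1/√(−t))} ‖V‖²`. [folklore] -/
theorem sqrt_mul_setIntegral_le_integral_cutoff (hV : ContDiff ℝ ∞ V) (hQ : ContDiff ℝ ∞ Q)
    (hdiv : VectorCalculus.IsDivFree V)
    (heq : ∀ y : EuclideanSpace ℝ (Fin 3), α • (rotGen (V y) - fderiv ℝ V y (rotGen y)) +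
      (1 / 2 : ℝ) • V y + (1 / 2 : ℝ) • fderiv ℝ V y y - (Δ V) y + fderiv ℝ V y (V y) +
      gradient Q y = 0)
    {φ : EuclideanSpace ℝ (Fin 3) → ℝ} (hφc : Continuous φ)
    (hφs : HasCompactSupport φ) (hφ0 : ∀ x, 0 ≤ φ x) {x₀ : EuclideanSpace ℝ (Fin 3)}
    (hφ1 : ∀ x ∈ ball x₀ 1, φ x = 1) {t : ℝ} (ht : t < 0) :
    Real.sqrt (-t) * ∫ y in ball ((Real.sqrt (-t))⁻¹ • rotZ (-(α * -Real.log (-t))) x₀)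
        (1 / Real.sqrt (-t)), ‖V y‖ ^ 2 ≤
      ∫ x, φ x * ‖pvAnsatz α (fun y _ => V y) t x‖ ^ 2 := by
  rw [← setIntegral_ball_norm_sq_pvAnsatz ht x₀ 1]
  have hNS := isClassicalNSSolutionOn_pvAnsatz_of_profile (α := α) hV hQ hdiv heq
  set u := pvAnsatz α (fun y _ => V y) with hu
  have hu_c : Continuous (u t) := (hNS.contDiff_velocity ht).continuous
  have cg : Continuous fun x => ‖u t x‖ ^ 2 := hu_c.norm.pow 2
  have i1 : Integrable fun x => φ x * ‖u t x‖ ^ 2 :=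
    (hφc.mul cg).integrable_of_hasCompactSupport hφs.mul_right
  rw [← integral_indicator measurableSet_ball]
  refine integral_mono ((integrable_indicator_iff measurableSet_ball).2
    ((cg.continuousOn.integrableOn_compact (isCompact_closedBall x₀ 1)).mono_set ball_subset_closedBall)) i1 fun x => ?_
  by_cases hx : x ∈ ball x₀ 1
  · rw [indicator_of_mem hx, hφ1 x hx, one_mul]
  · rw [indicator_of_notMem hx]
    exact mul_nonneg (hφ0 x) (by positivity)

/-- **The initial local energy** at `t = −1`: `∫ φ|u(−1)|² ≤ B ∫_{B(z, R)} ‖V‖²` for `|φ| ≤ B` vanishing off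
`B(x₀, R)`. [folklore] -/
theorem integral_cutoff_neg_one_le (hV : ContDiff ℝ ∞ V) (hQ : ContDiff ℝ ∞ Q)
    (hdiv : VectorCalculus.IsDivFree V)
    (heq : ∀ y : EuclideanSpace ℝ (Fin 3), α • (rotGen (V y) - fderiv ℝ V y (rotGen y)) +
      (1 / 2 : ℝ) • V y + (1 / 2 : ℝ) • fderiv ℝ V y y - (Δ V) y + fderiv ℝ V y (V y) +
      gradient Q y = 0)
    {φ : EuclideanSpace ℝ (Fin 3) → ℝ} (hφc : Continuous φ)
    (hφs : HasCompactSupport φ) {x₀ : EuclideanSpace ℝ (Fin 3)} {R B : ℝ} (hφB : ∀ x, |φ x| ≤ B)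
    (hφ0 : ∀ x, x ∉ ball x₀ R → φ x = 0) :
    ∫ x, φ x * ‖pvAnsatz α (fun y _ => V y) (-1) x‖ ^ 2 ≤
      B * ∫ y in ball (rotZ (-(α * -Real.log 1)) x₀) R, ‖V y‖ ^ 2 := by
  have hNS := isClassicalNSSolutionOn_pvAnsatz_of_profile (α := α) hV hQ hdiv heq
  have hu_c : Continuous (pvAnsatz α (fun y _ => V y) (-1)) :=
    (hNS.contDiff_velocity (by norm_num : (-1 : ℝ) ∈ Iio 0)).continuous
  have cg : Continuous fun x => ‖pvAnsatz α (fun y _ => V y) (-1) x‖ ^ 2 := hu_c.norm.pow 2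
  have h := integral_weight_mul_le hφB hφ0 cg (fun x => by positivity)
    ((hφc.mul cg).integrable_of_hasCompactSupport hφs.mul_right)
  refine h.trans (le_of_eq ?_)
  rw [setIntegral_ball_norm_sq_pvAnsatz (by norm_num : (-1 : ℝ) < 0) x₀ R]
  simp

end Flux

end LocalEnergyRescue

end Summit.NavierStokesRegularity.NavierStokesRegularity.Theorems.CoriolisHead

end
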